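import Mathlib
import Literature.Computability.AlgebraicComplexity.ValiantClasses
import Summits.ValiantsHypothesis.ValiantsHypothesis.Theorems.BarrierLeverSuccinctHittingSetsForVPGeneratorThree
import HarnessLib

/-!
# Crux `BarrierLever.DefinableEquations` (stmt-ValiantsHypothesis-8745) / item 8749
`SingleSizeEquations` — the GENERATOR WALL at exponent 3: no Boolean-sum witness at `b ≥ 3` is a
read-once formula or a product of sparse polynomials in the coefficient variables

Seat val-np-p5 g19 (docket 8745/8746/8749), sequel to `…GeneratorWall` (exponent 4).  In the crux's
own currency — a witness of `SingleSizeEquations` at `(n, b)` is a Boolean sum `E = boolSum H ≠ 0` in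
the `N = C(2n,n)` coefficient variables vanishing at `coeff(f)` for every `f ∈ SmallCircuits ℂ n b` —
this file records what the 14610-side rows of `…GeneratorThree` (the succinct Shpilka–Volkovich
generator with the NEW affine Lagrange seeds of `…AffineSeeds`, realised at exponent `3` by fast
multipoint evaluation) say about the SHAPE of such a witness:

* `boolSum_witness_not_prop_three` : for `n ≥ 2^14` and every `b ≥ 3`, NO witness `E` is computed
  by a preprocessed read-once formula in the coefficient variables (tree: `b ≥ 4`, `b ≥ 5`);
* `boolSum_witness_not_sparseProduct_three` : for `n ≥ 2^20 (a+1)²` and every `b ≥ 3`, NO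
  witness is a finite product of polynomials with at most `N^a` monomials each;
* level forms `prop_boolSum_not_equation_three`, `sparseProduct_boolSum_not_equation_three`.

So the doors "E a read-once formula in the c's" and "E a product of poly(N)-sparse polynomials"
are CLOSED at `b ≥ 3` and remain OPEN only at the open rung `b = 2` — where seed-by-seed
realisation of a shifted SV generator cannot close them (`2n` generic seeds, `n − 1` products each);
a joint realisation in `≤ n²` gates is not known (the grid values alone fit, `…SparsityWallTwo`).

Honest framing: a WALL (it excludes witnesses of a specific algebraic shape); the verdict on
8745/8749 is unchanged (OPEN at `b = 2`, Chatterjee–Tengse 2023 §1.3 direction 2); nothing here bears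
on `VP ≠ VNP`.

References: [ForbesShpilkaVolk2018] §3, Construction 29, Cor. 34, Question 6;
[ShpilkaVolkovich2015] Thm. 1; [ChatterjeeTengse2023] §1.3.
-/

-- layout Summits/ValiantsHypothesis/ValiantsHypothesis forces the duplicated namespace component
set_option linter.dupNamespace false

noncomputable section

namespace Summit.ValiantsHypothesis.ValiantsHypothesis.Theorems.BarrierLeverDefinableEquations

open Literature.Barriers.ValiantsHypothesis Literature.Computability.AlgebraicComplexity MvPolynomial
open Summit.ValiantsHypothesis.ValiantsHypothesis.Theorems.BarrierLever.SuccinctHittingSetsForVP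

namespace GeneratorWallThree

/-- **No Boolean-sum witness at `(n, b)`, `b ≥ 3`, `n ≥ 2^14`, is a preprocessed read-once formula
in the coefficient variables** (any `q`, size, degree of `H`). [cite: ForbesShpilkaVolk2018, §3] -/
theorem boolSum_witness_not_prop_three {n b q : ℕ} (hn : 2 ^ 14 ≤ n) (hb : 3 ≤ b)
    (H : MvPolynomial (degLEMonomials n ⊕ Fin q) ℂ) (hne : boolSum H ≠ 0)
    (hvan : ∀ f ∈ SmallCircuits ℂ n b,
      MvPolynomial.eval (coeffVector (degLEMonomials n) f) (boolSum H) = 0) :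
    ¬ ∃ S : Finset (degLEMonomials n), IsPROP S (boolSum H) := by
  rintro ⟨S, hS⟩
  obtain ⟨f, hf, hf0⟩ := readOnceHit_three_of_le hn (boolSum H) ⟨S, hS⟩ hne
  exact hf0 (hvan f (smallCircuits_mono ℂ hb (le_trans Nat.one_le_two_pow hn) hf))

/-- **Level form at exponent 3** (read-once witnesses fail to vanish on `SmallCircuits ℂ n b`,
`b ≥ 3`, `n ≥ 2^14`). [cite: ForbesShpilkaVolk2018, §3] -/
theorem prop_boolSum_not_equation_three {n b q : ℕ} (hn : 2 ^ 14 ≤ n) (hb : 3 ≤ b)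
    (H : MvPolynomial (degLEMonomials n ⊕ Fin q) ℂ) (S : Finset (degLEMonomials n))
    (hS : IsPROP S (boolSum H)) (hne : boolSum H ≠ 0) :
    ∃ f ∈ SmallCircuits ℂ n b,
      MvPolynomial.eval (coeffVector (degLEMonomials n) f) (boolSum H) ≠ 0 := by
  obtain ⟨f, hf, hf0⟩ := readOnceHit_three_of_le hn (boolSum H) ⟨S, hS⟩ hne
  exact ⟨f, smallCircuits_mono ℂ hb (le_trans Nat.one_le_two_pow hn) hf, hf0⟩

/-- **No Boolean-sum witness at `(n, b)`, `b ≥ 3`, `n ≥ 2^20 (a+1)²`, is a finite product of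
`N^a`-sparse polynomials in the coefficient variables.** [cite: ForbesShpilkaVolk2018, Cor. 34] -/
theorem boolSum_witness_not_sparseProduct_three {a n b q : ℕ} (hn : 2 ^ 20 * (a + 1) ^ 2 ≤ n)
    (hb : 3 ≤ b) (H : MvPolynomial (degLEMonomials n ⊕ Fin q) ℂ) (hne : boolSum H ≠ 0)
    (hvan : ∀ f ∈ SmallCircuits ℂ n b,
      MvPolynomial.eval (coeffVector (degLEMonomials n) f) (boolSum H) = 0) :
    ¬ ∃ (k : ℕ) (E : Fin k → MvPolynomial (degLEMonomials n) ℂ),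
        boolSum H = ∏ j, E j ∧ ∀ j, (E j).support.card ≤ Nat.choose (2 * n) n ^ a := by
  rintro ⟨k, E, hE, hEa⟩
  obtain ⟨f, hf, hf0⟩ :=
    isSuccinctHittingSet_sparseProducts_three_of_le hn (boolSum H) ⟨k, E, hE, hEa⟩ hne
  exact hf0 (hvan f (smallCircuits_mono ℂ hb
    (le_trans Nat.one_le_two_pow (le_trans (Nat.le_mul_of_pos_right _ (by positivity)) hn)) hf))

/-- **Level form at exponent 3** (sparse-product witnesses, `b ≥ 3`, `n ≥ 2^20 (a+1)²`).
[cite: ForbesShpilkaVolk2018, Cor. 34] -/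
theorem sparseProduct_boolSum_not_equation_three {a n b q : ℕ} (hn : 2 ^ 20 * (a + 1) ^ 2 ≤ n)
    (hb : 3 ≤ b) (H : MvPolynomial (degLEMonomials n ⊕ Fin q) ℂ)
    (k : ℕ) (E : Fin k → MvPolynomial (degLEMonomials n) ℂ) (hE : boolSum H = ∏ j, E j)
    (hEa : ∀ j, (E j).support.card ≤ Nat.choose (2 * n) n ^ a) (hne : boolSum H ≠ 0) :
    ∃ f ∈ SmallCircuits ℂ n b,
      MvPolynomial.eval (coeffVector (degLEMonomials n) f) (boolSum H) ≠ 0 := by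
  obtain ⟨f, hf, hf0⟩ :=
    isSuccinctHittingSet_sparseProducts_three_of_le hn (boolSum H) ⟨k, E, hE, hEa⟩ hne
  exact ⟨f, smallCircuits_mono ℂ hb
    (le_trans Nat.one_le_two_pow (le_trans (Nat.le_mul_of_pos_right _ (by positivity)) hn)) hf, hf0⟩

end GeneratorWallThree

end Summit.ValiantsHypothesis.ValiantsHypothesis.Theorems.BarrierLeverDefinableEquations

end
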